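import Summits.CriticalPhenomena.PercolationContinuityZ3.Theorems.PercNearOneGluingNoHeavyLowerTailSahiCoordinateDisjunctiveGluing
import Summits.CriticalPhenomena.PercolationContinuityZ3.Theorems.PercNearOneGluingNoHeavyLowerTailSahiClassTSingleCube
import Summits.CriticalPhenomena.PercolationContinuityZ3.Theorems.SahiMasterFamilyBernsteinGoodCoordinate
import Mathlib.Tactic.Linarith
import Mathlib.Tactic.Ring
import HarnessLib

/-!
# `NoHeavyLowerTail` (crux stmt-CriticalPhenomena-4575), master-family line P2 — THE SINGLE-MEMBER LEVEL-SPLITTING IDENTITY: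
# `E_3(X,Y,Z) = (1−t)·E_3(X⁰,Y,Z) + t·E_3(X¹,Y,Z) + t(1−t)·D_X`, the PIVOTAL-DENSITY DEFECT `D_X`, two absorption faces, and
# Kahn's `C_3` for `|T₃| ≤ 1` triples with a dense or absorbed pivotal set

Support file (seat `prim-masterthm-p2`, gen 25; `--supports stmt-CriticalPhenomena-4575`).  No definition, no `sorry`, standard axioms.
Memo `run/shared/lean/prim/prim-masterthm/FROM-prim-masterthm-p2-g25-LEVEL-SPLIT.md`, SAHI-ROUTE.md §4.49.

SETTING.  Events `X, Y, Z ⊆ 2^ι` on a finite cube with the product Bernoulli weight `μ_p`, a coordinate `e`, `t = p_e`, sections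
`W⁰ = secAt e false W`, `W¹ = secAt e true W` (events on the same cube, ignoring `e`), `m = μ_p`.  Freezing ONE member `X` at one of its two
`e`-sections gives the triples `(X⁰,Y,Z)` and `(X¹,Y,Z)` in which `Y, Z` keep their full dependence on `e`.

* `sahiE_three_eq_levelSplit` — **THE IDENTITY** (no monotonicity needed; `ring` after one-coordinate conditioning):
    `E_3(1_X,1_Y,1_Z) = (1−t)·E_3(1_{X⁰},1_Y,1_Z) + t·E_3(1_{X¹},1_Y,1_Z) + t(1−t)·D_X`,
    `D_X = E_m[(1_{X¹} − 1_{X⁰})·(2(1_{Y¹}1_{Z¹} − 1_{Y⁰}1_{Z⁰}) − m(Y)(1_{Z¹} − 1_{Z⁰}) − m(Z)(1_{Y¹} − 1_{Y⁰}))]`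
  (for increasing events `1_{X¹} − 1_{X⁰}`, `1_{Y¹} − 1_{Y⁰}`, `1_{Z¹} − 1_{Z⁰}` are the indicators of the three PIVOTAL sets `P, Q, R` of `e`, and
  `D_X = 2m(P∩Q∩R) + [2m(P∩Q∩Z⁰) − m(Z)·m(P∩Q)] + [2m(P∩R∩Y⁰) − m(Y)·m(P∩R)]`: `E_3` lies above the chord between the two `X`-frozen triples
  iff, on the joint pivotal sets `P∩Q`, `P∩R`, the third member is at least half as dense as on the whole cube, up to the bonus `2m(PQR)`).
  `ex_levelDefect_eq` is the moment expansion of `D_X`.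
* FACES (`levelDefect_nonneg_of_shell_subset_bottom`, `levelDefect_nonneg_of_shell_subset_tops`): for increasing `X, Y, Z`, `D_X ≥ 0` whenever the
  `e`-shell `X¹ ∖ X⁰` of `X` lies inside the BOTTOM section `Y⁰` of a partner (then `D_X = (2 − m(Y))·m(P∩R)`), or inside the meet `Y¹ ∩ Z¹` of the
  partner TOPS (pointwise `2(1−y₀z₀) − m(Y)(1−z₀) − m(Z)(1−y₀) ≥ y₀(1−z₀) + z₀(1−y₀) ≥ 0`).
* INHERITANCE (`sahiE_three_nonneg_of_levelDefect_nonneg`): `D_X ≥ 0` and `E_3 ≥ 0` for the two `X`-frozen triples ⟹ `E_3(X,Y,Z) ≥ 0`; indeed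
  `E_3(X,Y,Z) ≥ min(E_3(X⁰,Y,Z), E_3(X¹,Y,Z))` (`min_le_sahiE_three_of_levelDefect_nonneg`).  In the core induction of `…SahiClassTCoreStep` the frozen
  triples have smaller total essential support, so "some member's shell at some essential coordinate is absorbed by a partner bottom or by the partner
  tops" is a new peeling step (hypothesis-free, every `p`).
* **`|T₃| ≤ 1` (THEOREM, unconditional).**  If `e` is the only coordinate essential to all three of `X, Y, Z` (`hT1`), both `X`-frozen triples are CLASS T
  (no coordinate essential to all three: `esupp (secAt e b X) ⊆ esupp X ∖ {e}`), hence have `E_3 ≥ 0` for every `p` by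
  `SahiClassTCube.sahiE_three_nonneg_of_classT` (gen 8/14).  So: `sahiE_three_nonneg_of_T1_of_levelDefect_nonneg` — **Kahn's `C_3` holds at `p` for every
  triple with at most one triply-essential coordinate `e` and a member whose pivotal-density defect `D_X(p) ≥ 0`**; and, for every `p` at once,
  `sahiE_three_nonneg_of_T1_of_shell_subset_bottom` / `…_tops` — **Kahn's `C_3` for every such triple in which some member's `e`-shell lies in a partner's
  bottom `e`-section or in the meet of the partners' top `e`-sections.**  (Class T itself = no triply-essential coordinate; Theorem A = a pair sharing one
  coordinate.  Census, memo §2: the measure form covers 2 843 / 2 852 random `|T₃| = 1` cells on ≤ 7 section coins with SOME member, the structural form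
  22 820 / 83 880 = 27.2 % of the `|T₃| = 1` triples of the 4-cube; among 4-cube triples with `|T₃| ≥ 2`, 72.6 % have an absorbed shell at some
  triply-essential coordinate.)
HONEST FRAMING: an identity, two Harris-free pointwise faces and their corollaries; Kahn's Conjecture 5 / Sahi's `C_3` and its `|T₃| = 1` case in
full remain OPEN (the defect `D_X` is negative for every member on ≈ 0.3 % of random `|T₃| = 1` cells — memo §2 — where the class-T slack of the frozen
triples pays; the chord at the triply-essential coordinate itself fails on 11 532 / 10 485 000 exhaustive 4-cube `|T₃| = 1` cells). [this work]
-/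

noncomputable section

open scoped Classical

namespace Summit.CriticalPhenomena.PercolationContinuityZ3.Theorems

namespace SahiLevelSplit

open Finset Function
open Literature.Combinatorics.Sahi2008
open Literature.Probability.Percolation.DecisionTree (ind ind_of_mem ind_of_not_mem ind_nonneg)
open SahiCombDisjunct

variable {ι : Type} [Fintype ι]

attribute [local simp] secAt_inter secAt_union secAt_true_coord secAt_false_coord

/-! ### 1. The moment expansion of the defect and the level-splitting identity -/

section Identity

variable (p : ι → unitInterval) (e : ι) (X Y Z : Set (Set ι))

/-- **Moment expansion of the level-splitting defect** `D_X = E[(1_{X¹}−1_{X⁰})(2(1_{Y¹}1_{Z¹} − 1_{Y⁰}1_{Z⁰}) − m(Y)(1_{Z¹}−1_{Z⁰}) − m(Z)(1_{Y¹}−1_{Y⁰}))]`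
in terms of the section moments (pure linearity of `E`). [this work] -/
theorem ex_levelDefect_eq :
    ex (bernoulliWeight p) (fun ω =>
        (ind (secAt e true X) ω - ind (secAt e false X) ω) *
          (2 * (ind (secAt e true Y) ω * ind (secAt e true Z) ω - ind (secAt e false Y) ω * ind (secAt e false Z) ω)
            - ex (bernoulliWeight p) (ind Y) * (ind (secAt e true Z) ω - ind (secAt e false Z) ω)
            - ex (bernoulliWeight p) (ind Z) * (ind (secAt e true Y) ω - ind (secAt e false Y) ω))) =
      2 * (ex (bernoulliWeight p) (ind (secAt e true X ∩ secAt e true Y ∩ secAt e true Z))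
            - ex (bernoulliWeight p) (ind (secAt e false X ∩ secAt e true Y ∩ secAt e true Z))
            - ex (bernoulliWeight p) (ind (secAt e true X ∩ secAt e false Y ∩ secAt e false Z))
            + ex (bernoulliWeight p) (ind (secAt e false X ∩ secAt e false Y ∩ secAt e false Z)))
        - ex (bernoulliWeight p) (ind Y) *
            (ex (bernoulliWeight p) (ind (secAt e true X ∩ secAt e true Z)) - ex (bernoulliWeight p) (ind (secAt e false X ∩ secAt e true Z))
              - ex (bernoulliWeight p) (ind (secAt e true X ∩ secAt e false Z)) + ex (bernoulliWeight p) (ind (secAt e false X ∩ secAt e false Z)))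
        - ex (bernoulliWeight p) (ind Z) *
            (ex (bernoulliWeight p) (ind (secAt e true X ∩ secAt e true Y)) - ex (bernoulliWeight p) (ind (secAt e false X ∩ secAt e true Y))
              - ex (bernoulliWeight p) (ind (secAt e true X ∩ secAt e false Y)) + ex (bernoulliWeight p) (ind (secAt e false X ∩ secAt e false Y))) := by
  simp only [ex, Literature.Probability.Percolation.BHK2006.ind_inter, Finset.mul_sum, ← Finset.sum_sub_distrib, ← Finset.sum_add_distrib]
  refine Finset.sum_congr rfl fun ω _ => ?_
  ring

/-- **THE LEVEL-SPLITTING IDENTITY.**  For events `X, Y, Z`, a coordinate `e` with `t = p_e` and the sections `X⁰ = secAt e false X`, `X¹ = secAt e true X`: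
`E_3(1_X,1_Y,1_Z) = (1−t)·E_3(1_{X⁰},1_Y,1_Z) + t·E_3(1_{X¹},1_Y,1_Z) + t(1−t)·D_X` with the defect `D_X` of `ex_levelDefect_eq`.  No monotonicity is needed. [this work] -/
theorem sahiE_three_eq_levelSplit :
    sahiE (bernoulliWeight p) 3 ![ind X, ind Y, ind Z] =
      (1 - (p e : ℝ)) * sahiE (bernoulliWeight p) 3 ![ind (secAt e false X), ind Y, ind Z]
      + (p e : ℝ) * sahiE (bernoulliWeight p) 3 ![ind (secAt e true X), ind Y, ind Z]
      + (p e : ℝ) * (1 - (p e : ℝ)) *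
          ex (bernoulliWeight p) (fun ω =>
            (ind (secAt e true X) ω - ind (secAt e false X) ω) *
              (2 * (ind (secAt e true Y) ω * ind (secAt e true Z) ω - ind (secAt e false Y) ω * ind (secAt e false Z) ω)
                - ex (bernoulliWeight p) (ind Y) * (ind (secAt e true Z) ω - ind (secAt e false Z) ω)
                - ex (bernoulliWeight p) (ind Z) * (ind (secAt e true Y) ω - ind (secAt e false Y) ω))) := by
  rw [ex_levelDefect_eq]
  have hXYZ : ex (bernoulliWeight p) (ind (X ∩ Y ∩ Z)) =
      (p e : ℝ) * ex (bernoulliWeight p) (ind (secAt e true X ∩ secAt e true Y ∩ secAt e true Z)) +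
        (1 - (p e : ℝ)) * ex (bernoulliWeight p) (ind (secAt e false X ∩ secAt e false Y ∩ secAt e false Z)) :=
    ex_ind_of_secAt p e (by simp) (by simp)
  have hX : ex (bernoulliWeight p) (ind X) = (p e : ℝ) * ex (bernoulliWeight p) (ind (secAt e true X)) +
      (1 - (p e : ℝ)) * ex (bernoulliWeight p) (ind (secAt e false X)) := ex_ind_eq_secAt p e X
  have hY : ex (bernoulliWeight p) (ind Y) = (p e : ℝ) * ex (bernoulliWeight p) (ind (secAt e true Y)) +
      (1 - (p e : ℝ)) * ex (bernoulliWeight p) (ind (secAt e false Y)) := ex_ind_eq_secAt p e Y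
  have hZ : ex (bernoulliWeight p) (ind Z) = (p e : ℝ) * ex (bernoulliWeight p) (ind (secAt e true Z)) +
      (1 - (p e : ℝ)) * ex (bernoulliWeight p) (ind (secAt e false Z)) := ex_ind_eq_secAt p e Z
  have hXY : ex (bernoulliWeight p) (ind (X ∩ Y)) = (p e : ℝ) * ex (bernoulliWeight p) (ind (secAt e true X ∩ secAt e true Y)) +
      (1 - (p e : ℝ)) * ex (bernoulliWeight p) (ind (secAt e false X ∩ secAt e false Y)) :=
    ex_ind_of_secAt p e (by simp) (by simp)
  have hXZ : ex (bernoulliWeight p) (ind (X ∩ Z)) = (p e : ℝ) * ex (bernoulliWeight p) (ind (secAt e true X ∩ secAt e true Z)) +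
      (1 - (p e : ℝ)) * ex (bernoulliWeight p) (ind (secAt e false X ∩ secAt e false Z)) :=
    ex_ind_of_secAt p e (by simp) (by simp)
  have hYZ : ex (bernoulliWeight p) (ind (Y ∩ Z)) = (p e : ℝ) * ex (bernoulliWeight p) (ind (secAt e true Y ∩ secAt e true Z)) +
      (1 - (p e : ℝ)) * ex (bernoulliWeight p) (ind (secAt e false Y ∩ secAt e false Z)) :=
    ex_ind_of_secAt p e (by simp) (by simp)
  have h0YZ : ex (bernoulliWeight p) (ind (secAt e false X ∩ Y ∩ Z)) =
      (p e : ℝ) * ex (bernoulliWeight p) (ind (secAt e false X ∩ secAt e true Y ∩ secAt e true Z)) +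
        (1 - (p e : ℝ)) * ex (bernoulliWeight p) (ind (secAt e false X ∩ secAt e false Y ∩ secAt e false Z)) :=
    ex_ind_of_secAt p e (by simp [Pointwise.secAt_secAt_same]) (by simp [Pointwise.secAt_secAt_same])
  have h1YZ : ex (bernoulliWeight p) (ind (secAt e true X ∩ Y ∩ Z)) =
      (p e : ℝ) * ex (bernoulliWeight p) (ind (secAt e true X ∩ secAt e true Y ∩ secAt e true Z)) +
        (1 - (p e : ℝ)) * ex (bernoulliWeight p) (ind (secAt e true X ∩ secAt e false Y ∩ secAt e false Z)) :=
    ex_ind_of_secAt p e (by simp [Pointwise.secAt_secAt_same]) (by simp [Pointwise.secAt_secAt_same])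
  have h0Y : ex (bernoulliWeight p) (ind (secAt e false X ∩ Y)) =
      (p e : ℝ) * ex (bernoulliWeight p) (ind (secAt e false X ∩ secAt e true Y)) +
        (1 - (p e : ℝ)) * ex (bernoulliWeight p) (ind (secAt e false X ∩ secAt e false Y)) :=
    ex_ind_of_secAt p e (by simp [Pointwise.secAt_secAt_same]) (by simp [Pointwise.secAt_secAt_same])
  have h0Z : ex (bernoulliWeight p) (ind (secAt e false X ∩ Z)) =
      (p e : ℝ) * ex (bernoulliWeight p) (ind (secAt e false X ∩ secAt e true Z)) +
        (1 - (p e : ℝ)) * ex (bernoulliWeight p) (ind (secAt e false X ∩ secAt e false Z)) :=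
    ex_ind_of_secAt p e (by simp [Pointwise.secAt_secAt_same]) (by simp [Pointwise.secAt_secAt_same])
  have h1Y : ex (bernoulliWeight p) (ind (secAt e true X ∩ Y)) =
      (p e : ℝ) * ex (bernoulliWeight p) (ind (secAt e true X ∩ secAt e true Y)) +
        (1 - (p e : ℝ)) * ex (bernoulliWeight p) (ind (secAt e true X ∩ secAt e false Y)) :=
    ex_ind_of_secAt p e (by simp [Pointwise.secAt_secAt_same]) (by simp [Pointwise.secAt_secAt_same])
  have h1Z : ex (bernoulliWeight p) (ind (secAt e true X ∩ Z)) =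
      (p e : ℝ) * ex (bernoulliWeight p) (ind (secAt e true X ∩ secAt e true Z)) +
        (1 - (p e : ℝ)) * ex (bernoulliWeight p) (ind (secAt e true X ∩ secAt e false Z)) :=
    ex_ind_of_secAt p e (by simp [Pointwise.secAt_secAt_same]) (by simp [Pointwise.secAt_secAt_same])
  rw [sahiE_three, sahiE_three, sahiE_three]
  simp only [ind_mul_ind_eq_inter]
  rw [hXYZ, hX, hXY, hXZ, hYZ, h0YZ, h1YZ, h0Y, h0Z, h1Y, h1Z, hY, hZ]
  ring

end Identity

/-! ### 2. Two absorption faces for the defect -/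

section Faces

omit [Fintype ι] in
/-- For an increasing event the two sections are nested, pointwise on indicators. [folklore] -/
theorem ind_secAt_false_le (e : ι) {W : Set (Set ι)} (hW : IsUpperSet W) (ω : Set ι) :
    ind (secAt e false W) ω ≤ ind (secAt e true W) ω := by
  by_cases h : ω ∈ secAt e false W
  · rw [ind_of_mem h, ind_of_mem (RigidityAll.secAt_false_subset_secAt_true e hW h)]
  · rw [ind_of_not_mem h]; exact ind_nonneg _ _

omit [Fintype ι] in
/-- Indicators take the values `0` or `1`. [folklore] -/
theorem ind_eq_zero_or_one (W : Set (Set ι)) (ω : Set ι) : ind W ω = 0 ∨ ind W ω = 1 := by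
  by_cases h : ω ∈ W
  · exact Or.inr (ind_of_mem h)
  · exact Or.inl (ind_of_not_mem h)

/-- `0 ≤ μ_p(W) ≤ 1`. [folklore] -/
theorem ex_ind_mem_unitInterval (p : ι → unitInterval) (W : Set (Set ι)) :
    0 ≤ ex (bernoulliWeight p) (ind W) ∧ ex (bernoulliWeight p) (ind W) ≤ 1 := by
  refine ⟨ex_ind_nonneg' p W, ?_⟩
  have h := Pointwise.one_sub_ex_ind p W
  have h' := ex_ind_nonneg' p Wᶜ
  linarith

variable (p : ι → unitInterval) (e : ι) {X Y Z : Set (Set ι)} (hX : IsUpperSet X) (hY : IsUpperSet Y) (hZ : IsUpperSet Z)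
include hX hY hZ

/-- **FACE 1 (shell inside a partner's bottom).**  If the `e`-shell `X¹ ∖ X⁰` of the increasing event `X` lies in the bottom section `Y⁰` of the
increasing partner `Y` (i.e. `X` can be `e`-pivotal only where `Y` already holds without `e`), then `D_X ≥ 0`
(pointwise the integrand is `(2 − m(Y))·1_P·1_R ≥ 0`, `P, R` the pivotal sets of `X, Z`). [this work] -/
theorem levelDefect_nonneg_of_shell_subset_bottom (hPY : secAt e true X \ secAt e false X ⊆ secAt e false Y) :
    0 ≤ ex (bernoulliWeight p) (fun ω =>
        (ind (secAt e true X) ω - ind (secAt e false X) ω) *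
          (2 * (ind (secAt e true Y) ω * ind (secAt e true Z) ω - ind (secAt e false Y) ω * ind (secAt e false Z) ω)
            - ex (bernoulliWeight p) (ind Y) * (ind (secAt e true Z) ω - ind (secAt e false Z) ω)
            - ex (bernoulliWeight p) (ind Z) * (ind (secAt e true Y) ω - ind (secAt e false Y) ω))) := by
  obtain ⟨hmY0, hmY1⟩ := ex_ind_mem_unitInterval p Y
  refine ex_nonneg (isFKGMeasure_bernoulliWeight p).nonneg fun ω => ?_
  have hx := ind_secAt_false_le e hX ω
  have hz := ind_secAt_false_le e hZ ω
  by_cases hP : ω ∈ secAt e true X \ secAt e false X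
  · -- on the shell: `y⁰ = y¹ = 1`
    have hy0 : ind (secAt e false Y) ω = 1 := ind_of_mem (hPY hP)
    have hy1 : ind (secAt e true Y) ω = 1 := ind_of_mem (RigidityAll.secAt_false_subset_secAt_true e hY (hPY hP))
    rw [hy0, hy1]
    have : 0 ≤ (ind (secAt e true X) ω - ind (secAt e false X) ω) * ((2 - ex (bernoulliWeight p) (ind Y)) *
        (ind (secAt e true Z) ω - ind (secAt e false Z) ω)) :=
      mul_nonneg (sub_nonneg.2 hx) (mul_nonneg (by linarith) (sub_nonneg.2 hz))
    nlinarith [this]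
  · -- off the shell the first factor vanishes
    have h0 : ind (secAt e true X) ω - ind (secAt e false X) ω = 0 := by
      rw [Set.mem_sdiff, not_and, not_not] at hP
      by_cases h1 : ω ∈ secAt e true X
      · rw [ind_of_mem h1, ind_of_mem (hP h1)]; ring
      · have h0' : ω ∉ secAt e false X := fun h => h1 (RigidityAll.secAt_false_subset_secAt_true e hX h)
        rw [ind_of_not_mem h1, ind_of_not_mem h0']; ring
    rw [h0, zero_mul]

omit hY hZ in
/-- **FACE 2 (shell inside the meet of the partners' tops).**  If the `e`-shell `X¹ ∖ X⁰` lies in `Y¹ ∩ Z¹`, then `D_X ≥ 0`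
(pointwise on the shell `2(1 − y₀z₀) − m(Y)(1 − z₀) − m(Z)(1 − y₀) ≥ y₀(1−z₀) + z₀(1−y₀) ≥ 0`). [this work] -/
theorem levelDefect_nonneg_of_shell_subset_tops (hPT : secAt e true X \ secAt e false X ⊆ secAt e true Y ∩ secAt e true Z) :
    0 ≤ ex (bernoulliWeight p) (fun ω =>
        (ind (secAt e true X) ω - ind (secAt e false X) ω) *
          (2 * (ind (secAt e true Y) ω * ind (secAt e true Z) ω - ind (secAt e false Y) ω * ind (secAt e false Z) ω)
            - ex (bernoulliWeight p) (ind Y) * (ind (secAt e true Z) ω - ind (secAt e false Z) ω)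
            - ex (bernoulliWeight p) (ind Z) * (ind (secAt e true Y) ω - ind (secAt e false Y) ω))) := by
  obtain ⟨hmY0, hmY1⟩ := ex_ind_mem_unitInterval p Y
  obtain ⟨hmZ0, hmZ1⟩ := ex_ind_mem_unitInterval p Z
  refine ex_nonneg (isFKGMeasure_bernoulliWeight p).nonneg fun ω => ?_
  have hx := ind_secAt_false_le e hX ω
  by_cases hP : ω ∈ secAt e true X \ secAt e false X
  · have hy1 : ind (secAt e true Y) ω = 1 := ind_of_mem (hPT hP).1
    have hz1 : ind (secAt e true Z) ω = 1 := ind_of_mem (hPT hP).2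
    rw [hy1, hz1]
    have hy0 := ind_eq_zero_or_one (secAt e false Y) ω
    have hz0 := ind_eq_zero_or_one (secAt e false Z) ω
    have key : 0 ≤ 2 * (1 * 1 - ind (secAt e false Y) ω * ind (secAt e false Z) ω)
        - ex (bernoulliWeight p) (ind Y) * (1 - ind (secAt e false Z) ω)
        - ex (bernoulliWeight p) (ind Z) * (1 - ind (secAt e false Y) ω) := by
      rcases hy0 with h0 | h0 <;> rcases hz0 with h1 | h1 <;> rw [h0, h1] <;> nlinarith
    exact mul_nonneg (sub_nonneg.2 hx) key
  · have h0 : ind (secAt e true X) ω - ind (secAt e false X) ω = 0 := by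
      rw [Set.mem_sdiff, not_and, not_not] at hP
      by_cases h1 : ω ∈ secAt e true X
      · rw [ind_of_mem h1, ind_of_mem (hP h1)]; ring
      · have h0' : ω ∉ secAt e false X := fun h => h1 (RigidityAll.secAt_false_subset_secAt_true e hX h)
        rw [ind_of_not_mem h1, ind_of_not_mem h0']; ring
    rw [h0, zero_mul]

end Faces

/-! ### 3. Inheritance of `C_3` from the two frozen triples -/

section Inheritance

variable (p : ι → unitInterval) (e : ι) (X Y Z : Set (Set ι))

/-- **`E_3(X,Y,Z) ≥ min(E_3(X⁰,Y,Z), E_3(X¹,Y,Z))` whenever `D_X ≥ 0`** (the identity with `t ∈ [0,1]`). [this work] -/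
theorem min_le_sahiE_three_of_levelDefect_nonneg
    (hD : 0 ≤ ex (bernoulliWeight p) (fun ω =>
        (ind (secAt e true X) ω - ind (secAt e false X) ω) *
          (2 * (ind (secAt e true Y) ω * ind (secAt e true Z) ω - ind (secAt e false Y) ω * ind (secAt e false Z) ω)
            - ex (bernoulliWeight p) (ind Y) * (ind (secAt e true Z) ω - ind (secAt e false Z) ω)
            - ex (bernoulliWeight p) (ind Z) * (ind (secAt e true Y) ω - ind (secAt e false Y) ω)))) :
    min (sahiE (bernoulliWeight p) 3 ![ind (secAt e false X), ind Y, ind Z])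
        (sahiE (bernoulliWeight p) 3 ![ind (secAt e true X), ind Y, ind Z]) ≤
      sahiE (bernoulliWeight p) 3 ![ind X, ind Y, ind Z] := by
  rw [sahiE_three_eq_levelSplit p e X Y Z]
  have ht0 : 0 ≤ (p e : ℝ) := (p e).2.1
  have ht1 : (p e : ℝ) ≤ 1 := (p e).2.2
  have hA := min_le_left (sahiE (bernoulliWeight p) 3 ![ind (secAt e false X), ind Y, ind Z])
    (sahiE (bernoulliWeight p) 3 ![ind (secAt e true X), ind Y, ind Z])
  have hB := min_le_right (sahiE (bernoulliWeight p) 3 ![ind (secAt e false X), ind Y, ind Z])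
    (sahiE (bernoulliWeight p) 3 ![ind (secAt e true X), ind Y, ind Z])
  nlinarith [mul_nonneg ht0 (sub_nonneg.2 ht1), mul_nonneg (sub_nonneg.2 ht1) (sub_nonneg.2 hA), mul_nonneg ht0 (sub_nonneg.2 hB)]

/-- **INHERITANCE.**  `D_X ≥ 0` and `E_3 ≥ 0` for the two `X`-frozen triples `(X⁰,Y,Z)`, `(X¹,Y,Z)` give `E_3(X,Y,Z) ≥ 0`. [this work] -/
theorem sahiE_three_nonneg_of_levelDefect_nonneg
    (hD : 0 ≤ ex (bernoulliWeight p) (fun ω =>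
        (ind (secAt e true X) ω - ind (secAt e false X) ω) *
          (2 * (ind (secAt e true Y) ω * ind (secAt e true Z) ω - ind (secAt e false Y) ω * ind (secAt e false Z) ω)
            - ex (bernoulliWeight p) (ind Y) * (ind (secAt e true Z) ω - ind (secAt e false Z) ω)
            - ex (bernoulliWeight p) (ind Z) * (ind (secAt e true Y) ω - ind (secAt e false Y) ω))))
    (h0 : 0 ≤ sahiE (bernoulliWeight p) 3 ![ind (secAt e false X), ind Y, ind Z])
    (h1 : 0 ≤ sahiE (bernoulliWeight p) 3 ![ind (secAt e true X), ind Y, ind Z]) :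
    0 ≤ sahiE (bernoulliWeight p) 3 ![ind X, ind Y, ind Z] :=
  le_trans (le_min h0 h1) (min_le_sahiE_three_of_levelDefect_nonneg p e X Y Z hD)

end Inheritance

/-! ### 4. Triples with at most one triply-essential coordinate -/

section T1

variable (p : ι → unitInterval) (e : ι) {X Y Z : Set (Set ι)} (hX : IsUpperSet X) (hY : IsUpperSet Y) (hZ : IsUpperSet Z)
  (hT1 : ∀ x, x ≠ e → ¬ (x ∈ esupp X ∧ x ∈ esupp Y ∧ x ∈ esupp Z))
include hX hY hZ hT1

/-- If `e` is the only coordinate that may be essential to all three members, freezing one member at an `e`-section leaves a CLASS-T triple, which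
has `E_3 ≥ 0` for every product measure (`SahiClassTCube.sahiE_three_nonneg_of_classT`). [this work] -/
theorem sahiE_three_frozen_nonneg (b : Bool) : 0 ≤ sahiE (bernoulliWeight p) 3 ![ind (secAt e b X), ind Y, ind Z] := by
  refine SahiClassTCube.sahiE_three_nonneg_of_classT (isUpperSet_secAt e b hX) hY hZ (fun x hx => ?_) p
  have hx' := esupp_secAt_subset hX e b hx.1
  rw [Finset.mem_erase] at hx'
  exact hT1 x hx'.1 ⟨hx'.2, hx.2.1, hx.2.2⟩

/-- **KAHN'S `C_3` FOR `|T₃| ≤ 1` WITH A DENSE PIVOTAL SET.**  If `e` is the only coordinate essential to all three increasing events and the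
pivotal-density defect `D_X(p)` of some member (here the first) is `≥ 0`, then `E_3(μ_p; 1_X,1_Y,1_Z) ≥ 0`. [this work] -/
theorem sahiE_three_nonneg_of_T1_of_levelDefect_nonneg
    (hD : 0 ≤ ex (bernoulliWeight p) (fun ω =>
        (ind (secAt e true X) ω - ind (secAt e false X) ω) *
          (2 * (ind (secAt e true Y) ω * ind (secAt e true Z) ω - ind (secAt e false Y) ω * ind (secAt e false Z) ω)
            - ex (bernoulliWeight p) (ind Y) * (ind (secAt e true Z) ω - ind (secAt e false Z) ω)
            - ex (bernoulliWeight p) (ind Z) * (ind (secAt e true Y) ω - ind (secAt e false Y) ω)))) :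
    0 ≤ sahiE (bernoulliWeight p) 3 ![ind X, ind Y, ind Z] :=
  sahiE_three_nonneg_of_levelDefect_nonneg p e X Y Z hD (sahiE_three_frozen_nonneg p e hX hY hZ hT1 false)
    (sahiE_three_frozen_nonneg p e hX hY hZ hT1 true)

/-- **KAHN'S `C_3` FOR `|T₃| ≤ 1` WITH A SHELL ABSORBED BY A PARTNER'S BOTTOM (every `p`).**  If `e` is the only coordinate essential to all three
increasing events and the `e`-shell of `X` lies in the bottom `e`-section of `Y`, then `E_3(μ_p; 1_X,1_Y,1_Z) ≥ 0` for every `p`. [this work] -/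
theorem sahiE_three_nonneg_of_T1_of_shell_subset_bottom (hPY : secAt e true X \ secAt e false X ⊆ secAt e false Y) :
    0 ≤ sahiE (bernoulliWeight p) 3 ![ind X, ind Y, ind Z] :=
  sahiE_three_nonneg_of_T1_of_levelDefect_nonneg p e hX hY hZ hT1 (levelDefect_nonneg_of_shell_subset_bottom p e hX hY hZ hPY)

/-- **KAHN'S `C_3` FOR `|T₃| ≤ 1` WITH A SHELL INSIDE THE PARTNERS' TOPS (every `p`).**  If `e` is the only coordinate essential to all three increasing
events and the `e`-shell of `X` lies in `Y¹ ∩ Z¹`, then `E_3(μ_p; 1_X,1_Y,1_Z) ≥ 0` for every `p`. [this work] -/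
theorem sahiE_three_nonneg_of_T1_of_shell_subset_tops (hPT : secAt e true X \ secAt e false X ⊆ secAt e true Y ∩ secAt e true Z) :
    0 ≤ sahiE (bernoulliWeight p) 3 ![ind X, ind Y, ind Z] :=
  sahiE_three_nonneg_of_T1_of_levelDefect_nonneg p e hX hY hZ hT1 (levelDefect_nonneg_of_shell_subset_tops p e hX hPT)

end T1

end SahiLevelSplit

end Summit.CriticalPhenomena.PercolationContinuityZ3.Theorems
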